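import Mathlib
import HarnessLib
import Summits.HubbardSuperconductivity.HubbardSuperconductivity.Theorems.KLProgrammeKLRegimeSectorSlicePairWtFatData
import Summits.HubbardSuperconductivity.HubbardSuperconductivity.Theorems.KLProgrammeKLRegimeSectorSlicePairMoment

/-!
# Route `KLProgramme` — engine support, route (L2), FAT layer, WEIGHTED: the per-pair WEIGHTED character-sum bound for the FAT sector family
# `Ft = bgmFatMultiplier … (m+1)` and the zero-seed counterterm slice covariance on an admissible frame, UNIFORM over sector pairs

Cell `gate-hubbard-kl`, seat p3 (g10); program «W3α = α_w ROWS INSTANCE» (KL STATUS 2026-08-27 20:43Z; handed over by k3c3-p2 g8), file (α1):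
the weighted twin of k3c2-p3's `slicePair_bgmFat_le` (`…SectorSliceAlphaFat`) on k3c3-p2's weighted pair lemma `slicePairWt_charSum_l1_le`
(`…SectorSlicePairMoment`, mixed master: THIRD differences in time / axes / `v⊥` / `v` at isotropic rates, SECOND along `v` at the anisotropic rate).
Multiplier data of orders `≤ 2` from k3c2-p3's `…FatMultiplierPack` (uniform via `…SliceAlphaFatMono`), of order `3` from `…FatMultiplierPackThird`
(p558699) packaged by `iso3_pack_fat_le` (uniform datum `κ₃ᶠ·ℓ³/Λ_m³`); the SIX rate inequalities are hypotheses on UNIFORM data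
(`slicePair_lhs_mono`, `slicePair_lhs3_mono` transfer them to the actual data):

  **`slicePairWt_bgmFat_le`** — for every pair `(ω, ω′)` and every integer frame vector `v` of `ω` (`|v_j| ≤ N_r + ½`, `|v| ≥ N_r − 1`, tangency
  `|De_K(p_F(θ_ω))·(2π/L)v| ≤ (2π/L)(4+2A)`), the `(1 + s₀|z̃₁| + s₁|z̃₂|₁)`-weighted per-pair `ℓ¹` norm is
  `≤ √W_rates·√(24·2M·L²·N̄_s)·(βL²)⁻²·4βL²/Λ` given the six rate inequalities (orders 3/3/3/2/3), the `C³` frame datum `‖D³e_K‖ ≤ A₃` with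
  `A₃Λ_m² ≤ a₃`, the window `Λ′ < π(2M−5)/β`, `Λ_mβ < π(2M−5)` and the zone threshold `3|2π/L|(N_r+½) ≤ z`.

Everything is proved; no definitions. [cite: BenfattoGiulianiMastropietro2006, §2.7 (2.66)–(2.71a), §2.8 (2.81), Lemma 2.2]
-/

noncomputable section

namespace Summit.HubbardSuperconductivity.HubbardSuperconductivity.Theorems.TorusFourierL2

set_option linter.dupNamespace false -- summit = problem name (single-conjunct summit), D-0017

open Set Finset Literature.MathematicalPhysics.QuantumLattice Literature.MathematicalPhysics.QuantumLattice.BandSectorCounting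
open Literature.MathematicalPhysics.QuantumLattice.FermiRG Literature.Probability.LatticeModels Literature.Analysis.SpecialFunctions
open Summit.HubbardSuperconductivity.HubbardSuperconductivity.Theorems.DispersionFlow
open Summit.HubbardSuperconductivity.HubbardSuperconductivity.Theorems.KLRegimeSplit
open Summit.HubbardSuperconductivity.HubbardSuperconductivity.Theorems.KLProgrammeLegKernels
open Summit.HubbardSuperconductivity.HubbardSuperconductivity.Theorems.PerturbedFermiCurve
open scoped Real Nat

section PairBound

open Classical

variable {L M : ℕ} [NeZero L] [NeZero M] {a b : ℝ} (B : BandBounds a b) {K : TrigPolyC4v} {A : ℝ}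
  (hA : ∀ p : Momentum, ∀ j ≤ 2, ‖iteratedFDeriv ℝ j (frameShift K) p‖ ≤ A) (hADt : 2 * A < B.Dtmin)
  {μ e₀ z β : ℝ} (he : 0 < e₀) (hz : 0 < z) (hz1 : z ≤ 1) (hgap : e₀ + A + z ^ 2 < -μ) (h3 : e₀ + A - μ ≤ 3)
  (hlo : a ≤ μ - A - e₀) (hhi : μ + A + e₀ ≤ b) (hβ : 0 < β) (hρA : 4 * A < 2 * B.rhomin)
  (m : ℕ) (hMm : klScale e₀ m * β < π * (2 * M - 5))
  {d : ℝ} (hd : 0 ≤ d) (hd1 : ∀ u, |deriv (bgmCutoffSq e₀) u| ≤ d) (hd2 : ∀ u, |iteratedDeriv 2 (bgmCutoffSq e₀) u| ≤ d)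
  (hd3 : ∀ u, |iteratedDeriv 3 (bgmCutoffSq e₀) u| ≤ d)
  {A₃ a₃ : ℝ} (hA3 : ∀ p : Momentum, ‖iteratedFDeriv ℝ 3 (frameShift K) p‖ ≤ A₃) (ha3 : A₃ * klScale e₀ m ^ 2 ≤ a₃)
  {Ba : ℝ} (hB0 : 0 ≤ Ba)
  (hB : ∀ (i : ℕ), i ≤ 2 → ∀ (n : ℕ) (ω : ℤ) (θ₀ : ℝ) (q w : Fin 2 → ℝ) (t : ℝ) {r₀ : ℝ}, 0 < r₀ →
    r₀ ≤ ‖momToComplex (q + t • w)‖ → |sectorRelAngle θ₀ (q + t • w)| < π →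
    ‖iteratedDeriv i (fun t : ℝ => sectorWeightCirc n ω (polarAngle (q + t • w))) t‖ ≤
      (2 : ℕ)! * Ba * ((1 + (sectorWidth n)⁻¹ * (2 : ℕ)!) * ‖momToComplex w‖ / r₀) ^ i)
  {Ba3 : ℝ} (hB30 : 0 ≤ Ba3)
  (hB3 : ∀ (i : ℕ), i ≤ 3 → ∀ (n : ℕ) (ω : ℤ) (θ₀ : ℝ) (q w : Fin 2 → ℝ) (t : ℝ) {r₀ : ℝ}, 0 < r₀ →
    r₀ ≤ ‖momToComplex (q + t • w)‖ → |sectorRelAngle θ₀ (q + t • w)| < π →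
    ‖iteratedDeriv i (fun t : ℝ => sectorWeightCirc n ω (polarAngle (q + t • w))) t‖ ≤
      (3 : ℕ)! * Ba3 * ((1 + (sectorWidth n)⁻¹ * (3 : ℕ)!) * ‖momToComplex w‖ / r₀) ^ i)
  -- the slice and the Euclidean frame data of the propagator side
  {Λ Λ' : ℝ} (hΛ : 0 < Λ) (hΛΛ' : Λ ≤ Λ') (hM' : Λ' < π * (2 * M - 5) / β)
  {K₁ K₂ K₃ : ℝ} (hK₁ : ∀ p, ‖fderiv ℝ (frameLevel μ K) p‖ ≤ K₁) (hK₂ : ∀ p, ‖iteratedFDeriv ℝ 2 (frameLevel μ K) p‖ ≤ K₂)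
  (hK₃ : ∀ p, ‖iteratedFDeriv ℝ 3 (frameLevel μ K) p‖ ≤ K₃)
  {B₁ B₂ B₃ : ℝ} (hB₁ : ∀ x, |deriv salmhoferCutoff x| ≤ B₁) (hB₂ : ∀ x, |deriv (deriv salmhoferCutoff) x| ≤ B₂)
  (hB₃ : ∀ x, |deriv (deriv (deriv salmhoferCutoff)) x| ≤ B₃)
  -- tangent resolution, zone margin for the steps, far-region radius
  {Nr : ℝ} (hNr : 2 ≤ Nr) (hLz : 3 * |2 * π / L| * (Nr + 1 / 2) ≤ z) {R₀ : ℕ} (hR₀ : 2 * (2 * Nr + 1) * (R₀ : ℝ) < L)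
  -- abbreviations (instantiate with `rfl`)
  {ℓ₁ ℓ ρf G₁ G₂ G₃ Kp wsi τt Ae1 Ae2 An1 An2 Av1 Av2 κ₃F : ℝ}
  (hℓ₁ : ℓ₁ = 2 * π / L) (hℓ : ℓ = 2 * π / L * (Nr + 1 / 2))
  (hρf : ρf = (klScale e₀ m + B.smax * B.Dtmin * (3 * sectorWidth (m + 1) / 4)) / (B.Dtmin - 2 * A) +
    π * Real.sqrt 2 * (1 + (4 + 2 * A) / (B.Dtmin - 2 * A)) * sectorWidth (m + 1))
  (hG₁ : G₁ = d * e₀ ^ 2 * 1 + 1 * (d * e₀ ^ 2)) (hG₂ : G₂ = d * e₀ ^ 4 * 1 + 2 * (d * e₀ ^ 2) * (d * e₀ ^ 2) + 1 * (d * e₀ ^ 4))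
  (hG₃ : G₃ = d * e₀ ^ 6 * 1 + 3 * (d * e₀ ^ 4) * (d * e₀ ^ 2) + 3 * (d * e₀ ^ 2) * (d * e₀ ^ 4) + 1 * (d * e₀ ^ 6))
  (hκ₃F : κ₃F = (8 * G₃ + 12 * G₂) * (4 + 2 * A) ^ 3 + (12 * G₂ + 6 * G₁) * (4 + 2 * A) * (4 + 4 * A) * e₀ +
      2 * G₁ * (4 * e₀ ^ 2 + 8 * a₃) +
      216 * 9 * Ba3 * ((4 * G₂ + 2 * G₁) * (4 + 2 * A) ^ 2 * (2 * e₀) + 2 * G₁ * (4 + 4 * A) * e₀ * (2 * e₀)) +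
      216 * 9 * G₁ * (4 + 2 * A) * (12 * Ba3 + 72 * Ba3 ^ 2) * (2 * e₀) ^ 2 + 216 * 9 * (12 * Ba3 + 216 * Ba3 ^ 2) * (2 * e₀) ^ 3)
  (hKp : Kp = 4 + 4 * A) (hwsi : wsi = (sectorWidth (m + 1))⁻¹)
  (hτt : τt = |2 * π / L| * (4 + 2 * A) + K₂ * (Real.sqrt 2 * ρf) * (Real.sqrt 2 * ℓ))
  (hAe1 : Ae1 = 2 * G₁ * ((4 + 2 * A) * ℓ₁ + Kp * (ρf + 2 * ℓ₁) * ℓ₁) / klScale e₀ m * 1 + 1 * 1 * (9 * (4 * Ba * ((1 + 2 * wsi) * (2 * ℓ₁)))))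
  (hAe2 : Ae2 = ((4 * G₂ + 2 * G₁) * ((4 + 2 * A) * ℓ₁ + Kp * (ρf + 2 * ℓ₁) * ℓ₁) ^ 2 / klScale e₀ m ^ 2 + 2 * G₁ * (Kp * ℓ₁ ^ 2) / klScale e₀ m) * 1 +
    4 * G₁ * ((4 + 2 * A) * ℓ₁ + Kp * (ρf + 2 * ℓ₁) * ℓ₁) / klScale e₀ m * (9 * (4 * Ba * ((1 + 2 * wsi) * (2 * ℓ₁)))) +
    1 * 1 * (9 * (4 * Ba * ((1 + 2 * wsi) * (2 * ℓ₁)) ^ 2 + 8 * Ba ^ 2 * ((1 + 2 * wsi) * (2 * ℓ₁)) ^ 2)))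
  (hAn1 : An1 = 2 * G₁ * ((4 + 2 * A) * ℓ + Kp * (ρf + 2 * ℓ) * ℓ) / klScale e₀ m * 1 + 1 * 1 * (9 * (4 * Ba * ((1 + 2 * wsi) * (2 * ℓ)))))
  (hAn2 : An2 = ((4 * G₂ + 2 * G₁) * ((4 + 2 * A) * ℓ + Kp * (ρf + 2 * ℓ) * ℓ) ^ 2 / klScale e₀ m ^ 2 + 2 * G₁ * (Kp * ℓ ^ 2) / klScale e₀ m) * 1 +
    4 * G₁ * ((4 + 2 * A) * ℓ + Kp * (ρf + 2 * ℓ) * ℓ) / klScale e₀ m * (9 * (4 * Ba * ((1 + 2 * wsi) * (2 * ℓ)))) +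
    1 * 1 * (9 * (4 * Ba * ((1 + 2 * wsi) * (2 * ℓ)) ^ 2 + 8 * Ba ^ 2 * ((1 + 2 * wsi) * (2 * ℓ)) ^ 2)))
  (hAv1 : Av1 = 2 * G₁ * (|2 * π / L| * (4 + 2 * A) + Kp * (ρf + 2 * ℓ) * ℓ) / klScale e₀ m * 1 + 1 * 1 * (9 * (4 * Ba * ((1 + 2 * wsi) * (2 * ℓ)))))
  (hAv2 : Av2 = ((4 * G₂ + 2 * G₁) * (|2 * π / L| * (4 + 2 * A) + Kp * (ρf + 2 * ℓ) * ℓ) ^ 2 / klScale e₀ m ^ 2 + 2 * G₁ * (Kp * ℓ ^ 2) / klScale e₀ m) * 1 +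
    4 * G₁ * (|2 * π / L| * (4 + 2 * A) + Kp * (ρf + 2 * ℓ) * ℓ) / klScale e₀ m * (9 * (4 * Ba * ((1 + 2 * wsi) * (2 * ℓ)))) +
    1 * 1 * (9 * (4 * Ba * ((1 + 2 * wsi) * (2 * ℓ)) ^ 2 + 8 * Ba ^ 2 * ((1 + 2 * wsi) * (2 * ℓ)) ^ 2)))
  -- rates and the five UNIFORM inequalities

include B hA hADt he hz hz1 hgap h3 hlo hhi hβ hρA hMm hd hd1 hd2 hd3 hA3 ha3 hB0 hB hB30 hB3 hΛ hΛΛ' hM' hK₁ hK₂ hK₃ hB₁ hB₂ hB₃ hNr hLz hR₀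
  hℓ₁ hℓ hρf hG₁ hG₂ hG₃ hκ₃F hKp hwsi hτt hAe1 hAe2 hAn1 hAn2 hAv1 hAv2 in
set_option maxHeartbeats 4000000 in
/-- **The uniform WEIGHTED per-pair bound for the fat family** (see the module docstring). [cite: BenfattoGiulianiMastropietro2006, §2.8 (2.81)] -/
theorem slicePairWt_bgmFat_le (ω ω' : Fin (sectorCount (m + 1))) (v : Fin 2 → ℤ) (hv : v ≠ 0)
    (hvj : ∀ j, |(v j : ℝ)| ≤ Nr + 1 / 2) (hvlen : Nr - 1 ≤ Real.sqrt ((v 0 : ℝ) ^ 2 + (v 1 : ℝ) ^ 2))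
    (hvtan : |fderiv ℝ (fun p : Fin 2 → ℝ => frameLevel μ K (WithLp.toLp 2 p)) (klFermiPoint μ K (sectorCenter (m + 1) (ω : ℕ)))
      (fun j => 2 * π / L * (v j : ℝ))| ≤ |2 * π / L| * (4 + 2 * A))
    -- the rates and the SIX rate inequalities on the UNIFORM data
    {s₀ s₁ s₂ s₃ s₃' : ℝ} (hs₀ : 0 < s₀) (hs₁ : 0 < s₁) (hs₂ : 0 < s₂) (hs₃ : 0 < s₃) (hs₃' : 0 < s₃')
    (hr₀ : (1 / (β * (L : ℝ) ^ 2)) ^ 2 *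
        (1 * ((2 * π / β) ^ 3 * ((64 * B₃ + 480 * B₂ + 1728 * B₁ + 1536) * (β * (L : ℝ) ^ 2) / Λ ^ 4)) +
          3 * ((2 * G₁ * |2 * π / β| * 1 / klScale e₀ m) * ((2 * π / β) ^ 2 * ((32 * B₂ + 144 * B₁ + 128) * (β * (L : ℝ) ^ 2) / Λ ^ 3))) +
          3 * (((4 * G₂ + 2 * G₁) * (2 * π / β) ^ 2 * 1 / klScale e₀ m ^ 2) * ((2 * π / β) * ((16 * B₁ + 16) * (β * (L : ℝ) ^ 2) / Λ ^ 2))) +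
          ((8 * G₃ + 12 * G₂) * |2 * π / β| ^ 3 * 1 / klScale e₀ m ^ 3) * (4 * (β * (L : ℝ) ^ 2) / Λ)) ≤
      (1 / (β * (L : ℝ) ^ 2)) ^ 2 * (4 * (β * (L : ℝ) ^ 2) / Λ) * (4 / (s₀ * (2 * M : ℕ))) ^ 3)
    (hr₁ : (1 / (β * (L : ℝ) ^ 2)) ^ 2 *
        (1 * ((64 * B₃ + 480 * B₂ + 1728 * B₁ + 1536) * (β * (L : ℝ) ^ 2) / Λ ^ 4 *
              (K₁ * (Real.sqrt 2 * ℓ₁) + 6 * (K₂ * (Real.sqrt 2 * ℓ₁) ^ 2)) ^ 3 +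
            3 * ((32 * B₂ + 144 * B₁ + 128) * (β * (L : ℝ) ^ 2) / Λ ^ 3 * (K₁ * (Real.sqrt 2 * ℓ₁) + 6 * (K₂ * (Real.sqrt 2 * ℓ₁) ^ 2)) *
              (K₂ * (Real.sqrt 2 * ℓ₁) ^ 2)) +
            (16 * B₁ + 16) * (β * (L : ℝ) ^ 2) / Λ ^ 2 * (K₃ * (Real.sqrt 2 * ℓ₁) ^ 3)) +
          3 * (Ae1 * ((32 * B₂ + 144 * B₁ + 128) * (β * (L : ℝ) ^ 2) / Λ ^ 3 * (K₁ * (Real.sqrt 2 * ℓ₁) + 5 * (K₂ * (Real.sqrt 2 * ℓ₁) ^ 2)) ^ 2 +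
            (16 * B₁ + 16) * (β * (L : ℝ) ^ 2) / Λ ^ 2 * (K₂ * (Real.sqrt 2 * ℓ₁) ^ 2))) +
          3 * (Ae2 * ((16 * B₁ + 16) * (β * (L : ℝ) ^ 2) / Λ ^ 2 * (K₁ * (Real.sqrt 2 * ℓ₁) + 4 * (K₂ * (Real.sqrt 2 * ℓ₁) ^ 2)))) +
          κ₃F * ℓ₁ ^ 3 / klScale e₀ m ^ 3 * (4 * (β * (L : ℝ) ^ 2) / Λ)) ≤
      (1 / (β * (L : ℝ) ^ 2)) ^ 2 * (4 * (β * (L : ℝ) ^ 2) / Λ) * (4 / (s₁ * L)) ^ 3)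
    (hr₂ : (1 / (β * (L : ℝ) ^ 2)) ^ 2 *
        (1 * ((64 * B₃ + 480 * B₂ + 1728 * B₁ + 1536) * (β * (L : ℝ) ^ 2) / Λ ^ 4 *
              (K₁ * (Real.sqrt 2 * ℓ) + 6 * (K₂ * (Real.sqrt 2 * ℓ) ^ 2)) ^ 3 +
            3 * ((32 * B₂ + 144 * B₁ + 128) * (β * (L : ℝ) ^ 2) / Λ ^ 3 * (K₁ * (Real.sqrt 2 * ℓ) + 6 * (K₂ * (Real.sqrt 2 * ℓ) ^ 2)) *
              (K₂ * (Real.sqrt 2 * ℓ) ^ 2)) +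
            (16 * B₁ + 16) * (β * (L : ℝ) ^ 2) / Λ ^ 2 * (K₃ * (Real.sqrt 2 * ℓ) ^ 3)) +
          3 * (An1 * ((32 * B₂ + 144 * B₁ + 128) * (β * (L : ℝ) ^ 2) / Λ ^ 3 * (K₁ * (Real.sqrt 2 * ℓ) + 5 * (K₂ * (Real.sqrt 2 * ℓ) ^ 2)) ^ 2 +
            (16 * B₁ + 16) * (β * (L : ℝ) ^ 2) / Λ ^ 2 * (K₂ * (Real.sqrt 2 * ℓ) ^ 2))) +
          3 * (An2 * ((16 * B₁ + 16) * (β * (L : ℝ) ^ 2) / Λ ^ 2 * (K₁ * (Real.sqrt 2 * ℓ) + 4 * (K₂ * (Real.sqrt 2 * ℓ) ^ 2)))) +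
          κ₃F * ℓ ^ 3 / klScale e₀ m ^ 3 * (4 * (β * (L : ℝ) ^ 2) / Λ)) ≤
      (1 / (β * (L : ℝ) ^ 2)) ^ 2 * (4 * (β * (L : ℝ) ^ 2) / Λ) * (4 / (s₂ * L)) ^ 3)
    (hr₃ : (1 / (β * (L : ℝ) ^ 2)) ^ 2 *
        (1 * ((32 * B₂ + 144 * B₁ + 128) * (β * (L : ℝ) ^ 2) / Λ ^ 3 * (τt + 4 * (K₂ * (Real.sqrt 2 * ℓ) ^ 2)) ^ 2 +
            (16 * B₁ + 16) * (β * (L : ℝ) ^ 2) / Λ ^ 2 * (K₂ * (Real.sqrt 2 * ℓ) ^ 2)) +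
          2 * (Av1 * ((16 * B₁ + 16) * (β * (L : ℝ) ^ 2) / Λ ^ 2 * (τt + 3 * (K₂ * (Real.sqrt 2 * ℓ) ^ 2)))) +
          Av2 * (4 * (β * (L : ℝ) ^ 2) / Λ)) ≤
      (1 / (β * (L : ℝ) ^ 2)) ^ 2 * (4 * (β * (L : ℝ) ^ 2) / Λ) * (4 / (s₃ * L)) ^ 2)
    (hr₃' : (1 / (β * (L : ℝ) ^ 2)) ^ 2 *
        (1 * ((64 * B₃ + 480 * B₂ + 1728 * B₁ + 1536) * (β * (L : ℝ) ^ 2) / Λ ^ 4 * (τt + 6 * (K₂ * (Real.sqrt 2 * ℓ) ^ 2)) ^ 3 +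
            3 * ((32 * B₂ + 144 * B₁ + 128) * (β * (L : ℝ) ^ 2) / Λ ^ 3 * (τt + 6 * (K₂ * (Real.sqrt 2 * ℓ) ^ 2)) * (K₂ * (Real.sqrt 2 * ℓ) ^ 2)) +
            (16 * B₁ + 16) * (β * (L : ℝ) ^ 2) / Λ ^ 2 * (K₃ * (Real.sqrt 2 * ℓ) ^ 3)) +
          3 * (Av1 * ((32 * B₂ + 144 * B₁ + 128) * (β * (L : ℝ) ^ 2) / Λ ^ 3 * (τt + 5 * (K₂ * (Real.sqrt 2 * ℓ) ^ 2)) ^ 2 +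
            (16 * B₁ + 16) * (β * (L : ℝ) ^ 2) / Λ ^ 2 * (K₂ * (Real.sqrt 2 * ℓ) ^ 2))) +
          3 * (Av2 * ((16 * B₁ + 16) * (β * (L : ℝ) ^ 2) / Λ ^ 2 * (τt + 4 * (K₂ * (Real.sqrt 2 * ℓ) ^ 2)))) +
          κ₃F * ℓ ^ 3 / klScale e₀ m ^ 3 * (4 * (β * (L : ℝ) ^ 2) / Λ)) ≤
      (1 / (β * (L : ℝ) ^ 2)) ^ 2 * (4 * (β * (L : ℝ) ^ 2) / Λ) * (4 / (s₃' * L)) ^ 3) :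
    ∑ z : TorusSite 1 (2 * M) × TorusSite 2 L,
        (1 + s₀ * |(((z.1 0).valMinAbs : ℤ) : ℝ)| + s₁ * |(((z.2 0).valMinAbs : ℤ) : ℝ)| + s₁ * |(((z.2 1).valMinAbs : ℤ) : ℝ)|) *
        ‖∑ q : TorusSite 1 (2 * M) × TorusSite 2 L, (torusChar q.1 z.1 * torusChar q.2 z.2) •
          ((((1 / (β * (L : ℝ) ^ 2) : ℝ) : ℂ) ^ 2 *
            (bgmFatMultiplier L M e₀ β (nambuXiCT L μ K) (m + 1) ω (⟨(q.1 0).val, ZMod.val_lt (q.1 0)⟩, q.2) *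
              bgmFatMultiplier L M e₀ β (nambuXiCT L μ K) (m + 1) ω' (⟨(q.1 0).val, ZMod.val_lt (q.1 0)⟩, q.2) *
              sliceSymbolFnXi (β * (L : ℝ) ^ 2) 0 Λ Λ' (matsubaraFreq β M ⟨(q.1 0).val, ZMod.val_lt (q.1 0)⟩)
                (nambuXiCT L μ K q.2))))‖ ≤
      Real.sqrt (524288 * (1 / s₀ + 1) *
          ((1 + 2 * Real.sqrt 2 * s₁ / (s₂ * (Nr - 1)) + 2 * Real.sqrt 2 * s₁ / (s₃' * (Nr - 1))) ^ 2 *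
            ((2 * Real.sqrt 2 / (s₂ * (Nr - 1)) + 2) * (2 * Real.sqrt 2 / (s₃ * (Nr - 1)) + 2))
            + (1 / s₁ + 1) ^ 2 / (1 + s₁ * R₀))) *
        Real.sqrt (24 * (2 * M : ℕ) * (L : ℝ) ^ 2 *
          ((klScale e₀ m * β / π + 1) *
            ((Real.sqrt 2 * L * ((klScale e₀ m + (4 + 4 * A) * ρf ^ 2) / (2 * B.rhomin - 4 * A)) / π + 2) *
              (Real.sqrt 2 * L * (2 * ρf) / π + 2)))) *
        ((1 / (β * (L : ℝ) ^ 2)) ^ 2 * (4 * (β * (L : ℝ) ^ 2) / Λ)) := by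
  have hL : (0 : ℝ) < L := Nat.cast_pos.2 (Nat.pos_of_ne_zero (NeZero.ne L))
  have hπ := Real.pi_pos
  have hΛm : 0 < klScale e₀ m := by rw [klScale]; positivity
  have hA0 : 0 ≤ A := (norm_nonneg _).trans (hA 0 0 (by norm_num))
  have hK10 : 0 ≤ K₁ := le_trans (norm_nonneg _) (hK₁ 0)
  have hK20 : 0 ≤ K₂ := le_trans (norm_nonneg _) (hK₂ 0)
  have hK30 : 0 ≤ K₃ := le_trans (norm_nonneg _) (hK₃ 0)
  have hρf0 : 0 ≤ ρf := by
    have hDt : 0 < B.Dtmin - 2 * A := by linarith only [hADt]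
    rw [hρf]; have := B.smax_pos; have := B.Dtmin_pos; have := sectorWidth_pos (m + 1); positivity
  have hℓ₁0 : 0 < ℓ₁ := by rw [hℓ₁]; positivity
  have hNr0 : (0:ℝ) < Nr + 1 / 2 := by linarith only [hNr]
  have hℓ0 : 0 < ℓ := by rw [hℓ]; positivity
  have hKp0 : 0 ≤ Kp := by rw [hKp]; positivity
  have hwsi0 : 0 ≤ wsi := by rw [hwsi]; have := sectorWidth_pos (m + 1); positivity
  have hG₁0 : 0 ≤ G₁ := by rw [hG₁]; positivity
  have hG₂0 : 0 ≤ G₂ := by rw [hG₂]; positivity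
  have hG₃0 : 0 ≤ G₃ := by rw [hG₃]; positivity
  have hκ₃F0 : 0 ≤ κ₃F := by
    rw [hκ₃F]
    have ha30 : 0 ≤ a₃ := le_trans (by have := le_trans (norm_nonneg _) (hA3 0); positivity) ha3
    positivity
  obtain ⟨Gs, hGsdef⟩ : ∃ Gs : TorusSite 1 (2 * M) × TorusSite 2 L → ℂ, Gs = fun q =>
    bgmFatMultiplier L M e₀ β (nambuXiCT L μ K) (m + 1) ω (⟨(q.1 0).val, ZMod.val_lt (q.1 0)⟩, q.2) *
      bgmFatMultiplier L M e₀ β (nambuXiCT L μ K) (m + 1) ω' (⟨(q.1 0).val, ZMod.val_lt (q.1 0)⟩, q.2) := ⟨_, rfl⟩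
  obtain ⟨hM0, hNs, hMt₁, hMt₂, hMt₃, haxes, hnormal, htangent, hτE⟩ :=
    bgmFatPairWt_data B hA hADt he hz hz1 hgap h3 hlo hhi hβ hρA m hMm hd hd1 hd2 hd3 hA3 ha3 hB0 hB hB30 hB3 hK₂ hNr hLz
      hℓ₁ hℓ hρf hG₁ hG₂ hG₃ hκ₃F hKp hwsi hτt hAe1 hAe2 hAn1 hAn2 hAv1 hAv2 ω ω' v hvj hvtan Gs hGsdef
  have hat₁ : 0 ≤ 2 * G₁ * |2 * π / β| * 1 / klScale e₀ m := by positivity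
  have hat₂ : 0 ≤ (4 * G₂ + 2 * G₁) * (2 * π / β) ^ 2 * 1 / klScale e₀ m ^ 2 := by positivity
  have hat₃ : 0 ≤ (8 * G₃ + 12 * G₂) * |2 * π / β| ^ 3 * 1 / klScale e₀ m ^ 3 := by positivity
  have hvb : ‖(fun j => 2 * π / L * (v j : ℝ))‖ ≤ ℓ := by
    rw [hℓ]
    refine (pi_norm_le_iff_of_nonneg (by positivity)).2 fun j => ?_
    rw [Real.norm_eq_abs, abs_mul, abs_of_pos (by positivity : (0:ℝ) < 2 * π / L)]
    exact mul_le_mul_of_nonneg_left (hvj j) (by positivity)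
  have hnorm_u : ∀ (u : Fin 2 → ℤ) (b : ℝ), (∀ j, |(u j : ℝ)| ≤ b) → ‖(fun j => 2 * π / L * (u j : ℝ))‖ ≤ 2 * π / L * b := by
    intro u b hb
    refine (pi_norm_le_iff_of_nonneg (by
      have : 0 ≤ b := (abs_nonneg _).trans (hb 0); positivity)).2 fun j => ?_
    rw [Real.norm_eq_abs, abs_mul, abs_of_pos (by positivity : (0:ℝ) < 2 * π / L)]
    exact mul_le_mul_of_nonneg_left (hb j) (by positivity)
  have hne : ‖(WithLp.toLp 2 (fun i => 2 * π / L * (v i : ℝ)) : EuclideanSpace ℝ (Fin 2))‖ ≤ Real.sqrt 2 * ℓ :=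
    (norm_toLp_le _).trans (mul_le_mul_of_nonneg_left hvb (Real.sqrt_nonneg 2))
  have hτ0 : 0 ≤ τt := by rw [hτt]; positivity
  -- the rate inequalities on the ACTUAL data follow from the uniform ones by monotonicity
  have hR₀' : 2 * (|v 0| + |v 1|) * (R₀ : ℤ) < L := by
    have h0 := hvj 0; have h1 := hvj 1
    have : (2 * (|(v 0 : ℝ)| + |(v 1 : ℝ)|)) * (R₀ : ℝ) ≤ 2 * (2 * Nr + 1) * (R₀ : ℝ) :=
      mul_le_mul_of_nonneg_right (by linarith only [h0, h1]) (Nat.cast_nonneg _)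
    have : ((2 * (|v 0| + |v 1|) * (R₀ : ℤ) : ℤ) : ℝ) < (L : ℝ) := by
      push_cast; rw [← Int.cast_abs, ← Int.cast_abs]; push_cast; linarith only [this, hR₀]
    exact_mod_cast this
  have hne_axis : ∀ i : Fin 2, ‖(WithLp.toLp 2 (fun j => 2 * π / L * ((Pi.single i (1 : ℤ) : Fin 2 → ℤ) j : ℝ)) : EuclideanSpace ℝ (Fin 2))‖ ≤
      Real.sqrt 2 * ℓ₁ := by
    intro i
    refine (norm_toLp_le _).trans (mul_le_mul_of_nonneg_left ?_ (Real.sqrt_nonneg 2))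
    rw [hℓ₁]
    have hub : ∀ j, |(((Pi.single i (1 : ℤ) : Fin 2 → ℤ) j : ℤ) : ℝ)| ≤ 1 := by
      intro j; by_cases h : j = i
      · subst h; simp
      · simp [h]
    have := hnorm_u (Pi.single i 1) 1 hub; simpa using this
  have hne_n : ‖(WithLp.toLp 2 (fun j => 2 * π / L * ((![-v 1, v 0] : Fin 2 → ℤ) j : ℝ)) : EuclideanSpace ℝ (Fin 2))‖ ≤ Real.sqrt 2 * ℓ := by
    refine (norm_toLp_le _).trans (mul_le_mul_of_nonneg_left ?_ (Real.sqrt_nonneg 2))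
    rw [hℓ]
    refine hnorm_u _ _ fun j => ?_
    fin_cases j
    · show |(((-v 1 : ℤ) : ℤ) : ℝ)| ≤ Nr + 1 / 2
      rw [Int.cast_neg, abs_neg]; exact hvj 1
    · exact hvj 0
  have hc0 : (0 : ℝ) ≤ (1 / (β * (L : ℝ) ^ 2)) ^ 2 := by positivity
  have hC₂ : 0 ≤ 32 * B₂ + 144 * B₁ + 128 := by
    have : 0 ≤ B₁ := (abs_nonneg _).trans (hB₁ 0); have : 0 ≤ B₂ := (abs_nonneg _).trans (hB₂ 0); positivity
  have hC₁ : 0 ≤ 16 * B₁ + 16 := by have : 0 ≤ B₁ := (abs_nonneg _).trans (hB₁ 0); positivity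
  have hC₃ : 0 ≤ 64 * B₃ + 480 * B₂ + 1728 * B₁ + 1536 := by
    have : 0 ≤ B₁ := (abs_nonneg _).trans (hB₁ 0); have : 0 ≤ B₂ := (abs_nonneg _).trans (hB₂ 0)
    have : 0 ≤ B₃ := (abs_nonneg _).trans (hB₃ 0); positivity
  have hA3ℓ₁ : 0 ≤ κ₃F * ℓ₁ ^ 3 / klScale e₀ m ^ 3 := by positivity
  have hA3ℓ : 0 ≤ κ₃F * ℓ ^ 3 / klScale e₀ m ^ 3 := by positivity
  have hcβ : 0 ≤ β * (L : ℝ) ^ 2 := by positivity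
  have hAe10 : 0 ≤ Ae1 := by rw [hAe1]; positivity
  have hAe20 : 0 ≤ Ae2 := by rw [hAe2]; positivity
  have hAn10 : 0 ≤ An1 := by rw [hAn1]; positivity
  have hAn20 : 0 ≤ An2 := by rw [hAn2]; positivity
  have hAv10 : 0 ≤ Av1 := by rw [hAv1]; positivity
  have hAv20 : 0 ≤ Av2 := by rw [hAv2]; positivity
  have hmain := slicePairWt_charSum_l1_le (K := K) hβ hΛ hΛΛ' hM' hK₁ hK₂ hK₃ hB₁ hB₂ hB₃ Gs hM0 le_rfl v hv hR₀' hat₁ hat₂ hat₃ hMt₁ hMt₂ hMt₃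
    (fun _ => Ae1) (fun _ => Ae2) (fun _ => κ₃F * ℓ₁ ^ 3 / klScale e₀ m ^ 3) (fun _ => hAe10) (fun _ => hAe20) (fun _ => hA3ℓ₁)
    (fun q i => (haxes i).1 q) (fun q i => (haxes i).2.1 q) (fun q i => (haxes i).2.2 q)
    hAn10 hAn20 hA3ℓ hnormal.1 hnormal.2.1 hnormal.2.2 hAv10 hAv20 hA3ℓ htangent.1 htangent.2.1 htangent.2.2 hτ0 hτE
    hs₀ hs₁ hs₂ hs₃ hs₃' hr₀
    (fun i => le_trans (slicePair_lhs3_mono (s₅ := 5) (s₄ := 4) hc0 hC₃ hC₂ hC₁ hcβ hΛ hK20 hK30 (by norm_num) (by norm_num) hAe10 le_rfl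
      hAe20 le_rfl le_rfl (norm_nonneg _) (hne_axis i) (by positivity) (mul_le_mul_of_nonneg_left (hne_axis i) hK10)) (hr₁))
    (le_trans (slicePair_lhs3_mono (s₅ := 5) (s₄ := 4) hc0 hC₃ hC₂ hC₁ hcβ hΛ hK20 hK30 (by norm_num) (by norm_num) hAn10 le_rfl hAn20 le_rfl
      le_rfl (norm_nonneg _) hne_n (by positivity) (mul_le_mul_of_nonneg_left hne_n hK10)) hr₂)
    (le_trans (slicePair_lhs_mono (s₀ := 3) hc0 hC₂ hC₁ hcβ hΛ hK20 (by norm_num) hAv10 le_rfl le_rfl (norm_nonneg _) hne hτ0 le_rfl) hr₃)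
    (le_trans (slicePair_lhs3_mono (s₅ := 5) (s₄ := 4) hc0 hC₃ hC₂ hC₁ hcβ hΛ hK20 hK30 (by norm_num) (by norm_num) hAv10 le_rfl hAv20 le_rfl
      le_rfl (norm_nonneg _) hne hτ0 le_rfl) hr₃')
  -- final comparison: support count and the length of `v`
  have hLHS : ∀ q : TorusSite 1 (2 * M) × TorusSite 2 L,
      bgmFatMultiplier L M e₀ β (nambuXiCT L μ K) (m + 1) ω (⟨(q.1 0).val, ZMod.val_lt (q.1 0)⟩, q.2) *
        bgmFatMultiplier L M e₀ β (nambuXiCT L μ K) (m + 1) ω' (⟨(q.1 0).val, ZMod.val_lt (q.1 0)⟩, q.2) *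
        sliceSymbolFnXi (β * (L : ℝ) ^ 2) 0 Λ Λ' (matsubaraFreq β M ⟨(q.1 0).val, ZMod.val_lt (q.1 0)⟩) (nambuXiCT L μ K q.2) =
      Gs q * sliceSymbolFnXi (β * (L : ℝ) ^ 2) 0 Λ Λ' (matsubaraFreq β M ⟨(q.1 0).val, ZMod.val_lt (q.1 0)⟩) (nambuXiCT L μ K q.2) := by
    intro q; rw [hGsdef]
  simp_rw [hLHS]
  refine hmain.trans ?_
  have hA₀ : 0 ≤ (1 / (β * (L : ℝ) ^ 2)) ^ 2 * (4 * (β * (L : ℝ) ^ 2) / Λ) := by positivity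
  have hvpos : 0 < Real.sqrt ((v 0 : ℝ) ^ 2 + (v 1 : ℝ) ^ 2) := lt_of_lt_of_le (by linarith only [hNr]) hvlen
  have hNr1 : 0 < Nr - 1 := by linarith only [hNr]
  have hW : 524288 * (1 / s₀ + 1) *
        ((1 + 2 * Real.sqrt 2 * s₁ / (s₂ * Real.sqrt ((v 0 : ℝ) ^ 2 + (v 1 : ℝ) ^ 2)) +
            2 * Real.sqrt 2 * s₁ / (s₃' * Real.sqrt ((v 0 : ℝ) ^ 2 + (v 1 : ℝ) ^ 2))) ^ 2 *
          ((2 * Real.sqrt 2 / (s₂ * Real.sqrt ((v 0 : ℝ) ^ 2 + (v 1 : ℝ) ^ 2)) + 2) *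
            (2 * Real.sqrt 2 / (s₃ * Real.sqrt ((v 0 : ℝ) ^ 2 + (v 1 : ℝ) ^ 2)) + 2))
          + (1 / s₁ + 1) ^ 2 / (1 + s₁ * R₀)) ≤
      524288 * (1 / s₀ + 1) *
        ((1 + 2 * Real.sqrt 2 * s₁ / (s₂ * (Nr - 1)) + 2 * Real.sqrt 2 * s₁ / (s₃' * (Nr - 1))) ^ 2 *
          ((2 * Real.sqrt 2 / (s₂ * (Nr - 1)) + 2) * (2 * Real.sqrt 2 / (s₃ * (Nr - 1)) + 2))
          + (1 / s₁ + 1) ^ 2 / (1 + s₁ * R₀)) := by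
    have h2 : 2 * Real.sqrt 2 / (s₂ * Real.sqrt ((v 0 : ℝ) ^ 2 + (v 1 : ℝ) ^ 2)) ≤ 2 * Real.sqrt 2 / (s₂ * (Nr - 1)) :=
      div_le_div_of_nonneg_left (by positivity) (by positivity) (mul_le_mul_of_nonneg_left hvlen hs₂.le)
    have h3 : 2 * Real.sqrt 2 / (s₃ * Real.sqrt ((v 0 : ℝ) ^ 2 + (v 1 : ℝ) ^ 2)) ≤ 2 * Real.sqrt 2 / (s₃ * (Nr - 1)) :=
      div_le_div_of_nonneg_left (by positivity) (by positivity) (mul_le_mul_of_nonneg_left hvlen hs₃.le)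
    have h4 : 2 * Real.sqrt 2 * s₁ / (s₂ * Real.sqrt ((v 0 : ℝ) ^ 2 + (v 1 : ℝ) ^ 2)) ≤ 2 * Real.sqrt 2 * s₁ / (s₂ * (Nr - 1)) :=
      div_le_div_of_nonneg_left (by positivity) (by positivity) (mul_le_mul_of_nonneg_left hvlen hs₂.le)
    have h5 : 2 * Real.sqrt 2 * s₁ / (s₃' * Real.sqrt ((v 0 : ℝ) ^ 2 + (v 1 : ℝ) ^ 2)) ≤ 2 * Real.sqrt 2 * s₁ / (s₃' * (Nr - 1)) :=
      div_le_div_of_nonneg_left (by positivity) (by positivity) (mul_le_mul_of_nonneg_left hvlen hs₃'.le)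
    have h20 : 0 ≤ 2 * Real.sqrt 2 / (s₂ * Real.sqrt ((v 0 : ℝ) ^ 2 + (v 1 : ℝ) ^ 2)) := by positivity
    have h30 : 0 ≤ 2 * Real.sqrt 2 / (s₃ * Real.sqrt ((v 0 : ℝ) ^ 2 + (v 1 : ℝ) ^ 2)) := by positivity
    have h40 : 0 ≤ 1 + 2 * Real.sqrt 2 * s₁ / (s₂ * Real.sqrt ((v 0 : ℝ) ^ 2 + (v 1 : ℝ) ^ 2)) +
        2 * Real.sqrt 2 * s₁ / (s₃' * Real.sqrt ((v 0 : ℝ) ^ 2 + (v 1 : ℝ) ^ 2)) := by positivity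
    gcongr
  have hcardR : (24 * ((2 * M : ℕ) : ℝ) * (L : ℝ) ^ 2 * (((univ.filter fun q => Gs q ≠ 0).card : ℕ) : ℝ)) ≤
      24 * ((2 * M : ℕ) : ℝ) * (L : ℝ) ^ 2 *
        ((klScale e₀ m * β / π + 1) *
          ((Real.sqrt 2 * L * ((klScale e₀ m + (4 + 4 * A) * ρf ^ 2) / (2 * B.rhomin - 4 * A)) / π + 2) *
            (Real.sqrt 2 * L * (2 * ρf) / π + 2))) :=
    mul_le_mul_of_nonneg_left hNs (by positivity)
  gcongr

end PairBound

end Summit.HubbardSuperconductivity.HubbardSuperconductivity.Theorems.TorusFourierL2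

end
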